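import Mathlib
import HarnessLib
import HarnessLib.Audit
import Summits.Langlands.Langlands.Theorems.NearlyOrdinaryDistinguishedSplit
import Summits.Langlands.Langlands.Theorems.MordellWeilFifteenSplitPrelude

/-!
# MordellWeilFifteenSplit — lens-5 g35 node on RES34 = `NearlyOrdinaryDistinguishedSplit.Residual34` (and on REST_E): the MORDELL–WEIL GROWTH dial of `X₀(15)` over the witness field

TARGET (tree decl, BY NAME): RES34 = `Summit.Langlands.Langlands.Theorems.NearlyOrdinaryDistinguishedSplit.Residual34`
(g34, p834325) ⊂ REST = `TowerDoorSplit.UnanchoredHighDegreeWitnessAutomorphy` (stmt-Langlands-26998); the same cut is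
made one storey up on REST_E = `DepthIsolationSplit.UnanchoredHighDegreeModularE` (every integral `E` over every
unanchored totally real field `K₀` of degree `≥ 6` is modular).

THE DIAL (lens 5: finite/base range + asymptotic regime + bridge).  Parameter of the WITNESS FIELD `K₀` itself (not of
the curve, not a prime, not a subfield): the Mordell–Weil GROWTH of the two genus-one modular curves of level `15`,
`X(b3,b5) = X₀(15) ≅ E₁` (15A1) and `X(s3,b5) ≅ E₂` (15A3) [Thorne2019, Prop. 4], from `ℚ` to `K₀`:
`FifteenStable K₀ := E₁(K₀) = E₁(ℚ) ∧ E₂(K₀) = E₂(ℚ)` (the tree predicate `Thorne2019.PointsRational`, both Mordell–Weil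
groups `ℤ/2 ⊕ ℤ/4` over `ℚ`).
* FINITE / BASE RANGE = NO GROWTH (`√5 ∉ K₀`, `FifteenStable K₀`): CLOSED IN PRINT FOR EVERY DEGREE, with no anchor field,
  no solvability, no parity: a non-automorphic `E / K₀` is of Box shape (BOX13 = `Box2022_theorem1_3`, a NAMED tree fact:
  Borel-or-`C_s⁺` at `3`, Borel at `5` since `√5 ∉ K₀`), hence gives a NON-CUSPIDAL `K₀`-point of `X₀(15) ≅ E₁` or of
  `X(s3,b5) ≅ E₂` with the same `j` [Thorne2019, Lemma 3 (1) and the paragraph before it; FLS2015 §5]; that point is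
  `ℚ`-rational by stability, so `j(E) ∈ ℚ` (the `j`-map is defined over `ℚ`) — this moduli step is the node's ONE new
  print junction `FifteenModuliDoor` (FMD).  In the residual range (`[ℚ(j):ℚ] ≥ 4`) a rational `j` is absurd, so the
  stable sector of RES34 is EMPTY of candidates (closed from BOX13 ∧ FMD alone, `stableSector34_closed`); at the REST_E
  storey `j ∈ ℚ` is g27's rational-`j` door, closed from DBC (`RatBaseChangeModularity`, Dieulefait's base change), so
  the whole STABLE CELL of REST_E is closed (`stableCell_closed : BOX13 → FMD → DBC → StableFifteenCell`).  This is
  Thorne's Lemma 3 (2) with «`F/ℚ` cyclic + cyclic base change [Lan80]» replaced by «any totally real `F` + DBC»: a print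
  modularity theorem for a NAMED family of unanchored fields of UNBOUNDED degree — the generic (`S_d`-type) fields that
  no cell of `TowerDoorSplit` (A: abelian; B5/B7: Galois–solvable–odd anchor of degree `≤ 5`) and no door of g26–g34
  (all curve-local: image, signature, place, prime) reaches.
* ASYMPTOTIC REGIME = GROWTH (`√5 ∈ K₀`, or `E₁` or `E₂` acquires a new `K₀`-point): the declared residual `Residual35`
  (= RES34 restricted to growth fields; IDEA-NEEDED).  NAMED STRUCTURE gained: every residual curve lies in a fibre of
  `X₀(105)`, `X(s3,b5,b7)`, `X(b3,b5,e7)`, `X(s3,b5,e7)` (g31's cells) over a NON-rational `K₀`-point of `E₁` or `E₂`.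
* BRIDGE: the threshold is EXACTLY «no growth» (no effective constant is missing); beyond it only per-field instruments
  (2-descent on 15A1/`K₀`, Chabauty over `K₀` [Siksek2013]) — INSTRUMENTABLE per field, not closing.

GENUINE KERNEL CONTENT (0 sorry, beyond bookkeeping): (1) the explicit `2`-isogeny `φ : E₂ → E₁` with kernel
`⟨(1,−1)⟩`, `φ(x,y) = (x + 1/(x−1), y − (x+y)/(x−1)²)` (Vélu), as a checked identity of Weierstrass equations
(`isogeny_equation`); (2) DESCENT OF STABILITY: `E₁(K₀) = E₁(ℚ)` and `K₀` has NO QUADRATIC SUBFIELD ⇒ `E₂(K₀) = E₂(ℚ)`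
(`pointsRational_E₂_of_E₁`) — Yoshikawa's Cor. 3.3 [Yoshikawa2022] generalised from «odd degree» to «no quadratic
subfield» (odd degree ⇒ no quadratic subfield: `noQuadraticSubfield_of_not_two_dvd`), so on primitive / odd-degree
fields the door's guard is the single condition `E₁(K₀) = E₁(ℚ)`; (3) `j ∈ ℚ ⇒ [ℚ(j):ℚ] ≤ 1 ⇒ ¬ InResidualRange`.

PIECES and TAGS.  RES34 ⟸ FMD [PRINT JUNCTION, binder, credits nothing; Thorne2019 L3(1)+Prop 4, FLS2015 Lemmas 5.6–5.7]
∧ Residual35 [WEAKER (kernel: `residual35_of_residual34`), IDEA-NEEDED, INSTRUMENTABLE per field]; the stable sector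
`StableSector34` [WEAKER, CLOSED by kernel from BOX13 ∧ FMD]; EXACTNESS `residual34_iff_residual35`.  One storey up:
REST_E ⟸ StableFifteenCell [WEAKER, CLOSED from BOX13 ∧ FMD ∧ DBC] ∧ GrowthRestE [WEAKER, IDEA-NEEDED]; EXACTNESS
`restE_iff_growthRestE`.  Compositions BY NAME up to RES33, CORE, RES, LJR, REST_E and REST (stmt-Langlands-26998) through
g34's `signatureResidual_of_door` / `core_of_pieces34` / `closes_byName`.

WHY EACH PIECE IS STRICTLY WEAKER.  `Residual35`/`GrowthRestE` quantify over a sub-family of witness fields (growth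
fields) — implied by the parent outright; not equivalent to it unless the stable family is empty inside the box, and it
is not expected to be: stability is decided per field by 2-descent on 15A1 (rank `0` over `K₀`, no new `2`-power torsion;
odd torsion cannot grow over a totally real field missing `√5`, `√−3`, `√−15` by the surjectivity of `ρ̄_{E₁,ℓ}`,
`ℓ ≥ 3`, `Thorne2019_surjective_modEll_E₁`).  The stable pieces are closed, hence weaker than anything.

WHY NOVEL (relative to g26–g34 and the five sibling lenses).  Every earlier dial of the lineage is CURVE-LOCAL (moduli
degree, image shape at `3,5,7`, reduction signature, distinguished places) or a FIELD ANCHOR (abelian / solvable-odd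
sub-extension of degree `≤ 5`, B5/B7) — B5 with `F = ℚ` is the only overlap and it demands `K₀/ℚ` Galois, solvable, of
odd degree; this dial is an ABSOLUTE arithmetic statistic of `K₀` (a Mordell–Weil group), needs none of those, and its
finite range is print-closed in every degree.  Differs by construction from lens-1 (split-prime descent ladder on 14077),
lens-4 (torus pricing on the determinant lock), lens-6 (defect tables on 13936), lens-2/3 (prime-image / Serre-weight
nodes): none involves rational points of a modular curve over the witness field.
-/

set_option linter.dupNamespace false
set_option linter.unusedVariables false

open scoped NumberField IntermediateField MatrixGroups Polynomial
open NumberField IsDedekindDomain Field Literature.NumberTheory.Automorphic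
open Literature.NumberTheory.GaloisRepresentations
open Summit.Langlands.Langlands.Theorems.DepthIsolationSplit (UnanchoredBox UnanchoredHighDegreeModularE
  IntegralModelTransferPointwise SatakeAvatarTwo satakeAvatarTwo_of_host modularE_iff_box)
open Summit.Langlands.Langlands.Theorems.JDegreeFilterSplit (jInv jDeg InResidualRange LargeJResidual
  RatBaseChangeModularity SmallFieldBaseChange isModularEllipticCurve_of_jInv_eq_ratCast)
open Summit.Langlands.Langlands.Theorems.DyadicDoorSplit (AllenLocus AllenDyadicCorollary DyadicDegenerateResidual)
open Summit.Langlands.Langlands.Theorems.OddPrimeDoorSplit (OffDoors SkinnerWilesDihedralDoor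
  PanZhangSupersingularDoor CoreResidual core_of_restE)
open Summit.Langlands.Langlands.Theorems.RealCyclotomicDoorSplit (BorelAt BorelOrSplitCartanThree BoxShape
  boxShape_of_box13 not_isSquare_five_of_not_two_dvd)
open Summit.Langlands.Langlands.Theorems.ReductionSignatureSplit (OffSignatureDoors NearlyOrdinaryDihedralDoorThree
  SplitOrdinaryDihedralDoor MixedSignatureDoor SignatureResidual signatureResidual_of_core)
open Summit.Langlands.Langlands.Theorems.NearlyOrdinaryDistinguishedSplit (OnNODDoor NearlyOrdinaryDistinguishedDoor
  NODSector Residual34 nodSector_closed signatureResidual_of_pieces signatureResidual_of_door residual34_of_core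
  residual34_of_signatureResidual)

namespace Summit.Langlands.Langlands.Theorems.MordellWeilFifteenSplit

/-! ## §6 Compositions BY NAME up to RES33, CORE, REST_E and REST = stmt-Langlands-26998 (through g34) -/

/-- RES33 ⟸ NODD ∧ BOX13 ∧ FMD ∧ Residual35. -/
theorem signatureResidual_of_pieces35 (hNOD : NearlyOrdinaryDistinguishedDoor) (hB : Box2022_theorem1_3)
    (hF : FifteenModuliDoor) (hR : Residual35) : SignatureResidual :=
  signatureResidual_of_door hNOD (residual34_of_pieces hB hF hR)

/-- CORE ⟸ NOD₃ ∧ NOS ∧ MIX ∧ NODD ∧ BOX13 ∧ FMD ∧ Residual35 (through g34's `core_of_pieces34`). -/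
theorem core_of_pieces35 (hNO3 : NearlyOrdinaryDihedralDoorThree) (hNOS : SplitOrdinaryDihedralDoor)
    (hMIX : MixedSignatureDoor) (hNOD : NearlyOrdinaryDistinguishedDoor) (hB : Box2022_theorem1_3)
    (hF : FifteenModuliDoor) (hR : Residual35) : CoreResidual :=
  Summit.Langlands.Langlands.Theorems.NearlyOrdinaryDistinguishedSplit.core_of_pieces34 hNO3 hNOS hMIX hNOD
    (residual34_of_pieces hB hF hR)

/-- REST_E ⟸ … ∧ NODD ∧ BOX13 ∧ FMD ∧ Residual35 (through g34's `restE_of_pieces34`). -/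
theorem restE_of_pieces35 (hDBC : RatBaseChangeModularity) (hNSBC : SmallFieldBaseChange)
    (hFLS : FLS2015_theorem1) (hDNS : DNS2020_theorem4) (hBox : Box2022_theorem1_1)
    (hADC : AllenDyadicCorollary) (h34 : FLS2015_theorems3_4) (hSW : SkinnerWilesDihedralDoor)
    (hPZ : PanZhangSupersingularDoor) (hNO3 : NearlyOrdinaryDihedralDoorThree) (hNOS : SplitOrdinaryDihedralDoor)
    (hMIX : MixedSignatureDoor) (hNOD : NearlyOrdinaryDistinguishedDoor) (hB : Box2022_theorem1_3)
    (hF : FifteenModuliDoor) (hR : Residual35) : UnanchoredHighDegreeModularE :=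
  Summit.Langlands.Langlands.Theorems.NearlyOrdinaryDistinguishedSplit.restE_of_pieces34 hDBC hNSBC hFLS hDNS hBox hADC
    h34 hSW hPZ hNO3 hNOS hMIX hNOD (residual34_of_pieces hB hF hR)

/-- KERNEL COMPOSITION concluding REST = `TowerDoorSplit.UnanchoredHighDegreeWitnessAutomorphy` (stmt-Langlands-26998)
BY NAME, through g34's `closes_target`, with `Residual34` replaced by BOX13 ∧ FMD ∧ Residual35. -/
theorem closes_target (hDBC : RatBaseChangeModularity) (hNSBC : SmallFieldBaseChange)
    (hFLS : FLS2015_theorem1) (hDNS : DNS2020_theorem4) (hBox : Box2022_theorem1_1)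
    (hADC : AllenDyadicCorollary) (h34 : FLS2015_theorems3_4) (hSW : SkinnerWilesDihedralDoor)
    (hPZ : PanZhangSupersingularDoor) (hNO3 : NearlyOrdinaryDihedralDoorThree) (hNOS : SplitOrdinaryDihedralDoor)
    (hMIX : MixedSignatureDoor) (hNOD : NearlyOrdinaryDistinguishedDoor) (hB : Box2022_theorem1_3)
    (hF : FifteenModuliDoor) (hR : Residual35)
    (hIMT : IntegralModelTransferPointwise)
    (hTr : Summit.Langlands.Langlands.Theses.EllipticDegreeLadder.EllipticTransportAnyBase)
    (hW : SatakeAvatarTwo)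
    (h1 : Summit.Langlands.Langlands.Theses.EllipticDegreeLadder.RankOneAutomorphy) :
    Summit.Langlands.Langlands.Theses.TowerDoorSplit.UnanchoredHighDegreeWitnessAutomorphy :=
  Summit.Langlands.Langlands.Theorems.NearlyOrdinaryDistinguishedSplit.closes_target hDBC hNSBC hFLS hDNS hBox hADC h34
    hSW hPZ hNO3 hNOS hMIX hNOD (residual34_of_pieces hB hF hR) hIMT hTr hW h1

/-- `closes_target` with W⁺ the host item `SatakeAvatarExistence` (stmt-Langlands-17415) BY NAME. -/
theorem closes_byName (hDBC : RatBaseChangeModularity) (hNSBC : SmallFieldBaseChange)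
    (hFLS : FLS2015_theorem1) (hDNS : DNS2020_theorem4) (hBox : Box2022_theorem1_1)
    (hADC : AllenDyadicCorollary) (h34 : FLS2015_theorems3_4) (hSW : SkinnerWilesDihedralDoor)
    (hPZ : PanZhangSupersingularDoor) (hNO3 : NearlyOrdinaryDihedralDoorThree) (hNOS : SplitOrdinaryDihedralDoor)
    (hMIX : MixedSignatureDoor) (hNOD : NearlyOrdinaryDistinguishedDoor) (hB : Box2022_theorem1_3)
    (hF : FifteenModuliDoor) (hR : Residual35)
    (hIMT : IntegralModelTransferPointwise)
    (hTr : Summit.Langlands.Langlands.Theses.EllipticDegreeLadder.EllipticTransportAnyBase)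
    (hW : Summit.Langlands.Langlands.Theses.EllipticDegreeLadder.SatakeAvatarExistence)
    (h1 : Summit.Langlands.Langlands.Theses.EllipticDegreeLadder.RankOneAutomorphy) :
    Summit.Langlands.Langlands.Theses.TowerDoorSplit.UnanchoredHighDegreeWitnessAutomorphy :=
  closes_target hDBC hNSBC hFLS hDNS hBox hADC h34 hSW hPZ hNO3 hNOS hMIX hNOD hB hF hR hIMT hTr
    (satakeAvatarTwo_of_host hW) h1

/-! ### Necessity from the lineage targets (the trivial direction) -/

/-- CORE ⟹ Residual35. -/
theorem residual35_of_core (h : CoreResidual) : Residual35 :=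
  residual35_of_residual34 (residual34_of_core h)

/-- REST_E ⟹ Residual35. -/
theorem residual35_of_restE (h : UnanchoredHighDegreeModularE) : Residual35 :=
  residual35_of_core (core_of_restE h)

/-- EXACTNESS at CORE modulo the junctions: CORE ⟺ Residual35. -/
theorem core_iff_residual35 (hNO3 : NearlyOrdinaryDihedralDoorThree) (hNOS : SplitOrdinaryDihedralDoor)
    (hMIX : MixedSignatureDoor) (hNOD : NearlyOrdinaryDistinguishedDoor) (hB : Box2022_theorem1_3)
    (hF : FifteenModuliDoor) : CoreResidual ↔ Residual35 :=
  ⟨residual35_of_core, core_of_pieces35 hNO3 hNOS hMIX hNOD hB hF⟩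

/-! ## §9 THE CRITERION IN ABSOLUTE FORM (every totally real field, any degree, anchored or not) -/

/-- THE THORNE–YOSHIKAWA CRITERION, ABSOLUTE FORM (box-free; CLOSED from BOX13 ∧ FMD ∧ DBC): over ANY totally real `K` with
`√5 ∉ K`, `E₁(K) = E₁(ℚ)` and `E₂(K) = E₂(ℚ)`, every integral `E` is modular.  [Thorne2019, Lemma 3 (2)] has this for
`K/ℚ` CYCLIC (cyclic base change [Lan80]); [Yoshikawa2022, Cor. 3.6] for `K ⊂ F_∞`, `F` real quadratic; here the base
change input is DBC (g27's junction `RatBaseChangeModularity`, Dieulefait), so NO condition on `K/ℚ` remains. -/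
theorem modular_of_stable (hB : Box2022_theorem1_3) (hF : FifteenModuliDoor) (hDBC : RatBaseChangeModularity)
    (K : Type) [Field K] [NumberField K] [IsTotallyReal K] (h5 : ¬ IsSquare (5 : K)) (hst : FifteenStable K)
    (E : WeierstrassCurve (𝓞 K)) (hΔ : E.Δ ≠ 0) : IsModularEllipticCurve K E := by
  by_cases hmod : IsAutomorphicOfWeightZero E
  · exact (IsHilbertModular.of_isAutomorphicOfWeightZero hΔ hmod).isModularEllipticCurve
  · obtain ⟨q, hq⟩ := ratCast_of_not_automorphic hB hF K h5 hst E hΔ hmod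
    exact isModularEllipticCurve_of_jInv_eq_ratCast hDBC K E hΔ q hq.symm

/-- ODD DEGREE: ONE MORDELL–WEIL COMPUTATION.  Over a totally real `K` of ODD degree, `X₀(15)(K) = X₀(15)(ℚ)` ALONE
(i.e. `E₁(K) = E₁(ℚ)`) implies that every integral `E / K` is modular (given BOX13, FMD, DBC): `√5 ∉ K` is automatic
(g31's `not_isSquare_five_of_not_two_dvd`) and `E₂(K) = E₂(ℚ)` follows by the kernel descent `pointsRational_E₂_of_E₁`.
This is the `F = ℚ` instance of `TowerDoorSplit`'s cell B5 with its «`K/ℚ` Galois and solvable» hypotheses REMOVED. -/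
theorem modular_of_X0FifteenStable_odd (hB : Box2022_theorem1_3) (hF : FifteenModuliDoor)
    (hDBC : RatBaseChangeModularity) (K : Type) [Field K] [NumberField K] [IsTotallyReal K]
    (hodd : Odd (Module.finrank ℚ K)) (h₁ : Thorne2019.PointsRational Thorne2019.E₁ K)
    (E : WeierstrassCurve (𝓞 K)) (hΔ : E.Δ ≠ 0) : IsModularEllipticCurve K E :=
  have h2 : ¬ 2 ∣ Module.finrank ℚ K := by obtain ⟨k, hk⟩ := hodd; omega
  modular_of_stable hB hF hDBC K (not_isSquare_five_of_not_two_dvd h2)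
    (fifteenStable_of_E₁ (noQuadraticSubfield_of_not_two_dvd h2) h₁) E hΔ

/-- No quadratic subfield ⇒ `√5 ∉ K` (a square root of `5` would be an irrational root of `X² − 5`). -/
theorem not_isSquare_five_of_noQuadraticSubfield {K : Type} [Field K] [NumberField K] (hK : NoQuadraticSubfield K) :
    ¬ IsSquare (5 : K) := by
  rintro ⟨r, hr⟩
  have h5 : ¬ IsSquare (5 : ℚ) := by
    rw [show (5 : ℚ) = ((5 : ℕ) : ℚ) by norm_num, Rat.isSquare_natCast_iff]
    rintro ⟨a, ha⟩
    have ha' : a ≤ 2 := by nlinarith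
    interval_cases a <;> omega
  have hr2 : r ^ 2 = 5 := by rw [sq]; exact hr.symm
  refine Box2022.sqrt_five_not_mem_range h5 hr2 (mem_range_of_quadratic hK r 0 (-5) ?_)
  simp only [map_zero, zero_mul, add_zero, map_neg, map_ofNat]
  rw [hr2]; norm_num

/-- NO QUADRATIC SUBFIELD (e.g. primitive fields of degree `≠ 2`): `√5 ∉ K` is again automatic and the criterion reads
`E₁(K) = E₁(ℚ)` alone. -/
theorem modular_of_X0FifteenStable_noQuadratic (hB : Box2022_theorem1_3) (hF : FifteenModuliDoor)
    (hDBC : RatBaseChangeModularity) (K : Type) [Field K] [NumberField K] [IsTotallyReal K]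
    (hK : NoQuadraticSubfield K) (h₁ : Thorne2019.PointsRational Thorne2019.E₁ K)
    (E : WeierstrassCurve (𝓞 K)) (hΔ : E.Δ ≠ 0) : IsModularEllipticCurve K E :=
  modular_of_stable hB hF hDBC K (not_isSquare_five_of_noQuadraticSubfield hK) (fifteenStable_of_E₁ hK h₁) E hΔ

end Summit.Langlands.Langlands.Theorems.MordellWeilFifteenSplit
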